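import Literature.Analysis.FluidPDE.HardSphereWindowEvent
import Literature.Analysis.FluidPDE.HardSphereFlowRestart
import HarnessLib

/-!
# Windows of an orbit: the single-collision event from the count of collisions
(Cercignani–Illner–Pulvirenti 1994 App. 4.A–4.B; Gallagher–Saint-Raymond–Texier 2013 Prop. 4.1.1;
trunk T-KINETIC, topic Analysis/FluidPDE; step C1 (window bookkeeping) of the plan for the
one-step mild BBGKY hierarchy almost everywhere, input (H1) of `hs_seriesFamily_ae_eq_of_oneStep`.)

For a good datum `y` of the collision-by-collision flow and a time window `(a, b]` of its forward
orbit, this file relates the single-collision event of `HardSphereWindowEvent`, applied to the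
restarted datum `Φ_a y` with window length `b - a`, to the collision instants of `y`:

* `collisionCount_spec` — `t_c ≤ u < t_{c+1}` for `c = collisionCount y u` (forward-good orbit);
* `fwdFlow_mem_singleCollisionEvent` — if exactly one instant `t_{c+1}` of `y` lies in `(a, b]`
  (`t_c ≤ a < t_{c+1} ≤ b < t_{c+2}`) and the orbit has the pair `(I, J)` in contact at that instant,
  then `Φ_a y ∈ singleCollisionEvent G ε I J (b - a)` (restart identities of `HardSphereFlowRestart`);
* `two_le_collisionCount_sub_of_contact` — if the orbit has a contact at some time of `(a, b]`
  but `Φ_a y` is in no single-collision event of length `b - a` for that contact pair, then at least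
  two instants lie in `(a, b]`: `collisionCount y b ≥ collisionCount y a + 2` — the *dirty*
  windows of the derivation of the BBGKY hierarchy.

## References

* C. Cercignani, R. Illner, M. Pulvirenti, *The Mathematical Theory of Dilute Gases*, Springer
  (1994), App. 4.A pp. 107–111, App. 4.B.
* I. Gallagher, L. Saint-Raymond, B. Texier, *From Newton to Boltzmann*, EMS (2013),
  arXiv:1208.5753, Prop. 4.1.1.
-/

open MeasureTheory Set Filter Topology Function
open scoped ENNReal

namespace Literature.Analysis.FluidPDE

noncomputable section

section Kinetic

variable {d : Type*} [Fintype d] {X : Type*} {N : ℕ}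

namespace Alexander

variable {G : Geometry d X} {ε : ℝ} [TopologicalSpace X] [T2Space X]

omit [TopologicalSpace X] [T2Space X] in
/-- **The collision count locates the segment**: `t_c ≤ u < t_{c+1}` for `c = collisionCount y u`
on a forward-good orbit. [folklore] -/
theorem collisionCount_spec {y : Config N d X} (hgood : FwdGood G ε y) (u : ℝ) :
    collisionInstant G ε y (collisionCount G ε y u) ≤ ENNReal.ofReal u ∧
      ENNReal.ofReal u < collisionInstant G ε y (collisionCount G ε y u + 1) := by
  obtain ⟨k, h1, h2⟩ := hgood.exists_segment u
  rw [collisionCount_eq_of_segment h1 h2]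
  exact ⟨h1, h2⟩

omit [TopologicalSpace X] [T2Space X] in
/-- An instant `t_k ≤ u` (finite) forces `k ≤ collisionCount y u`; an instant `t_k > u` forces
`collisionCount y u < k` (forward-good orbit). [folklore] -/
theorem le_collisionCount_iff {y : Config N d X} (hgood : FwdGood G ε y) {u : ℝ} {k : ℕ} :
    k ≤ collisionCount G ε y u ↔ collisionInstant G ε y k ≤ ENNReal.ofReal u := by
  obtain ⟨h1, h2⟩ := collisionCount_spec hgood u
  constructor
  · intro hk
    exact (monotone_collisionInstant y hk).trans h1
  · intro hk
    by_contra hlt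
    have hle : collisionCount G ε y u + 1 ≤ k := Nat.succ_le_of_lt (not_le.1 hlt)
    exact (not_le.2 h2) ((monotone_collisionInstant y hle).trans hk)

/-- **The restarted datum of a window with exactly one instant, at which the pair `(I, J)` is in
contact, belongs to the single-collision event** of that pair and of the window length
(`collisionInstant_fwdFlow_succ_add`: the instants of `Φ_a y` are those of `y` shifted by `a`; the
first exit configuration of `Φ_a y` is the pre-collisional configuration of `y` at `t_{c+1}`, whose
positions are those of the post-collisional one). [folklore] -/
theorem fwdFlow_mem_singleCollisionEvent (hG : G.IsHardSphereRegular ε) {y : Config N d X} (hy : y ∈ good G ε)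
    {a b : ℝ} (ha : 0 ≤ a) (hab : a ≤ b) {c : ℕ}
    (h1 : collisionInstant G ε y c ≤ ENNReal.ofReal a) (h2 : ENNReal.ofReal a < collisionInstant G ε y (c + 1))
    (h3 : collisionInstant G ε y (c + 1) ≤ ENNReal.ofReal b) (h4 : ENNReal.ofReal b < collisionInstant G ε y (c + 2))
    {I J : Fin N} (hc : fwdFlow G ε y (collisionInstant G ε y (c + 1)).toReal ∈ contactSet G N ε I J) :
    fwdFlow G ε y a ∈ singleCollisionEvent G ε I J (b - a) := by
  have hgood : FwdGood G ε y := hy.2.2.1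
  set z := fwdFlow G ε y a with hz
  -- `z` is good
  have hzg : z ∈ good G ε := by
    have := mapsTo_flow_good (N := N) hG a hy
    rwa [flow_of_nonneg ha] at this
  -- the instants of the restarted datum
  have hfin1 : collisionInstant G ε y (c + 1) ≠ ∞ := ne_top_of_le_ne_top ENNReal.ofReal_ne_top h3
  have hr1 : collisionInstant G ε z 1 + ENNReal.ofReal a = collisionInstant G ε y (c + 1) := by
    have := collisionInstant_fwdFlow_succ_add ha h1 h2 0
    simpa using this
  have hr2 : collisionInstant G ε z 2 + ENNReal.ofReal a = collisionInstant G ε y (c + 2) := by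
    have := collisionInstant_fwdFlow_succ_add ha h1 h2 1
    simpa using this
  have hba : ENNReal.ofReal (b - a) + ENNReal.ofReal a = ENNReal.ofReal b := by
    rw [← ENNReal.ofReal_add (sub_nonneg.2 hab) ha, sub_add_cancel]
  have hz1 : collisionInstant G ε z 1 ≤ ENNReal.ofReal (b - a) := by
    have h : collisionInstant G ε z 1 + ENNReal.ofReal a ≤ ENNReal.ofReal (b - a) + ENNReal.ofReal a := by
      rw [hr1, hba]; exact h3
    exact (ENNReal.add_le_add_iff_right ENNReal.ofReal_ne_top).1 h
  have hz2 : ENNReal.ofReal (b - a) < collisionInstant G ε z 2 := by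
    have h : ENNReal.ofReal (b - a) + ENNReal.ofReal a < collisionInstant G ε z 2 + ENNReal.ofReal a := by
      rw [hr2, hba]; exact h4
    exact (ENNReal.add_lt_add_iff_right ENNReal.ofReal_ne_top).1 h
  -- the first exit configuration of `z` is the pre-collisional configuration of `y` at `t_{c+1}`
  have hfin1z : collisionInstant G ε z 1 ≠ ∞ := ne_top_of_le_ne_top ENNReal.ofReal_ne_top hz1
  have ht₁ : (collisionInstant G ε z 1).toReal = (collisionInstant G ε y (c + 1)).toReal - a := by
    have := congrArg ENNReal.toReal hr1
    rw [ENNReal.toReal_add hfin1z ENNReal.ofReal_ne_top, ENNReal.toReal_ofReal ha] at this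
    linarith
  have hfinc : collisionInstant G ε y c ≠ ∞ := ne_top_of_le_ne_top ENNReal.ofReal_ne_top h1
  have hexit : freeExitTime G ε (stateAfter G ε y c) ≠ ∞ := by
    intro htop
    apply hfin1
    rw [collisionInstant_succ, htop]; simp
  obtain ⟨p, hp, hstate⟩ := hgood.exists_stateAfter_succ hexit
  -- `S_{t₁(z)} z = S_{τ(y_c)} y_c`
  have hzff : freeFlight G (collisionInstant G ε z 1).toReal z =
      freeFlight G (freeExitTime G ε (stateAfter G ε y c)).toReal (stateAfter G ε y c) := by
    rw [ht₁, hz, fwdFlow_eq_of_segment h1 h2, ← freeFlight_add]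
    congr 1
    have := congrArg ENNReal.toReal (collisionInstant_succ (G := G) (ε := ε) y c)
    rw [ENNReal.toReal_add hfinc hexit] at this
    linarith
  -- positions at `t_{c+1}`: post-collisional (in contact for `(I, J)`) and pre-collisional agree
  have hpost : fwdFlow G ε y (collisionInstant G ε y (c + 1)).toReal = stateAfter G ε y (c + 1) :=
    hgood.fwdFlow_collisionInstant hG hfin1 (Or.inl (Nat.succ_pos c))
  have hpre : freeFlight G (freeExitTime G ε (stateAfter G ε y c)).toReal (stateAfter G ε y c) ∈ contactSet G N ε I J := by
    rw [hpost, hstate] at hc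
    exact (mem_contactSet_congr_fst fun k => collidePair_apply_fst _ k).1 hc
  refine ⟨hzg, hz1, hz2, ?_⟩
  rw [hzff]
  exact hpre

/-- **Dirty windows have at least two instants.** If the forward orbit of a good datum `y` has a
contact of a pair `(I, J)` at some time of the window `(a, b]` while the restarted datum `Φ_a y` is
not in the single-collision event of `(I, J)` of length `b - a`, then at least two collision
instants of `y` lie in `(a, b]`: `collisionCount y a + 2 ≤ collisionCount y b`. [folklore] -/
theorem two_le_collisionCount_sub_of_contact (hG : G.IsHardSphereRegular ε) {y : Config N d X} (hy : y ∈ good G ε)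
    {a b : ℝ} (ha : 0 ≤ a) (hab : a ≤ b) {τ : ℝ} (hτ : τ ∈ Ioc a b) {I J : Fin N} (hIJ : I ≠ J)
    (hc : fwdFlow G ε y τ ∈ contactSet G N ε I J)
    (hnot : fwdFlow G ε y a ∉ singleCollisionEvent G ε I J (b - a)) :
    collisionCount G ε y a + 2 ≤ collisionCount G ε y b := by
  have hgood : FwdGood G ε y := hy.2.2.1
  have hτ0 : 0 < τ := ha.trans_lt hτ.1
  -- the contact time is an instant `t_k`, `k > 0`
  obtain ⟨-, k, hk, hTk⟩ := hgood.mem_instantSet_of_fwdFlow_mem_contactSet hτ0 hIJ hc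
  set c := collisionCount G ε y a with hcdef
  -- `c < k ≤ collisionCount y b`
  have hck : c < k := by
    by_contra hle
    have h := (le_collisionCount_iff hgood).1 (not_lt.1 hle)
    rw [hTk] at h
    exact (not_lt.2 h) ((ENNReal.ofReal_lt_ofReal_iff hτ0).2 hτ.1)
  have hkb : k ≤ collisionCount G ε y b := by
    rw [le_collisionCount_iff hgood, hTk]
    exact ENNReal.ofReal_le_ofReal hτ.2
  -- if only one instant were in the window, `Φ_a y` would be in the event
  by_contra hlt
  have hcb : collisionCount G ε y b = c + 1 := by omega
  have hk1 : k = c + 1 := by omega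
  subst hk1
  obtain ⟨h1, h2⟩ := collisionCount_spec hgood a
  obtain ⟨-, h4⟩ := collisionCount_spec hgood b
  rw [← hcdef] at h1 h2
  rw [hcb] at h4
  have h3 : collisionInstant G ε y (c + 1) ≤ ENNReal.ofReal b := by
    rw [hTk]; exact ENNReal.ofReal_le_ofReal hτ.2
  have hcτ : fwdFlow G ε y (collisionInstant G ε y (c + 1)).toReal ∈ contactSet G N ε I J := by
    rw [hTk, ENNReal.toReal_ofReal hτ0.le]; exact hc
  exact hnot (fwdFlow_mem_singleCollisionEvent hG hy ha hab h1 h2 h3 h4 hcτ)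


omit [T2Space X] in
/-- **The single-collision event described by the orbit.** For a positive window length `δ` and a
pair `I ≠ J`, a datum belongs to `singleCollisionEvent G ε I J δ` iff it is good, its forward orbit
has the pair `(I, J)` in contact at some time of `(0, δ]`, and all the times of `(0, δ]` at which
some pair is in contact coincide (contacts of a forward-good orbit happen exactly at its collision
instants, which are strictly increasing). This description is covariant along the orbit and under
relabellings. [folklore] -/
theorem mem_singleCollisionEvent_iff_orbit (hG : G.IsHardSphereRegular ε) {I J : Fin N} (hIJ : I ≠ J) {δ : ℝ} (hδ : 0 < δ)
    {z : Config N d X} :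
    z ∈ singleCollisionEvent G ε I J δ ↔
      z ∈ good G ε ∧ (∃ τ ∈ Ioc 0 δ, fwdFlow G ε z τ ∈ contactSet G N ε I J) ∧
      ∀ τ₁ ∈ Ioc 0 δ, ∀ τ₂ ∈ Ioc 0 δ,
        (∃ i j : Fin N, i ≠ j ∧ fwdFlow G ε z τ₁ ∈ contactSet G N ε i j) →
        (∃ i j : Fin N, i ≠ j ∧ fwdFlow G ε z τ₂ ∈ contactSet G N ε i j) → τ₁ = τ₂ := by
  constructor
  · intro hz
    obtain ⟨hτpos, hτle, -, -, -⟩ := singleCollisionEvent_structure hG hIJ hz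
    obtain ⟨hzg, h1, h2, hc⟩ := hz
    have hgood : FwdGood G ε z := hzg.2.2.1
    have hfin : collisionInstant G ε z 1 ≠ ∞ := ne_top_of_le_ne_top ENNReal.ofReal_ne_top h1
    -- every contact time of the window is the first instant
    have huniq : ∀ τ ∈ Ioc 0 δ, (∃ i j : Fin N, i ≠ j ∧ fwdFlow G ε z τ ∈ contactSet G N ε i j) →
        τ = (collisionInstant G ε z 1).toReal := by
      rintro τ hτ ⟨i, j, hij, hcτ⟩
      obtain ⟨-, k, hk, hTk⟩ := hgood.mem_instantSet_of_fwdFlow_mem_contactSet hτ.1 hij hcτ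
      have hk2 : k < 2 := by
        by_contra hk2
        have hle : collisionInstant G ε z 2 ≤ collisionInstant G ε z k := monotone_collisionInstant z (not_lt.1 hk2)
        rw [hTk] at hle
        exact (not_lt.2 (hle.trans (ENNReal.ofReal_le_ofReal hτ.2))) h2
      obtain rfl : k = 1 := by omega
      rw [hTk, ENNReal.toReal_ofReal hτ.1.le]
    refine ⟨hzg, ⟨(collisionInstant G ε z 1).toReal, ⟨hτpos, hτle⟩, ?_⟩, fun τ₁ hτ₁ τ₂ hτ₂ h₁ h₂ => ?_⟩
    · -- the contact at the first instant (post-collisional positions are the pre-collisional ones)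
      have hexit : freeExitTime G ε (stateAfter G ε z 0) ≠ ∞ := by rwa [stateAfter_zero, ← collisionInstant_one]
      obtain ⟨p, hp, hstate⟩ := hgood.exists_stateAfter_succ hexit
      rw [stateAfter_zero, zero_add, ← collisionInstant_one] at hstate
      rw [hgood.fwdFlow_collisionInstant hG hfin (Or.inl Nat.one_pos), hstate]
      exact (mem_contactSet_congr_fst fun k => collidePair_apply_fst _ k).2 hc
    · rw [huniq τ₁ hτ₁ h₁, huniq τ₂ hτ₂ h₂]
  · rintro ⟨hzg, ⟨τ, hτ, hcτ⟩, huniq⟩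
    have hgood : FwdGood G ε z := hzg.2.2.1
    -- the contact time is an instant `t_k`, in fact `t_1`
    obtain ⟨-, k, hk, hTk⟩ := hgood.mem_instantSet_of_fwdFlow_mem_contactSet hτ.1 hIJ hcτ
    have hfin1 : collisionInstant G ε z 1 ≠ ∞ :=
      ne_top_of_le_ne_top (by rw [hTk]; exact ENNReal.ofReal_ne_top) (monotone_collisionInstant z hk)
    have hpos1 : 0 < (collisionInstant G ε z 1).toReal := by
      rw [collisionInstant_one]
      refine ENNReal.toReal_pos (freeExitTime_pos_of_mem_good hG hzg).ne' ?_
      rwa [← collisionInstant_one]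
    have h1le : collisionInstant G ε z 1 ≤ ENNReal.ofReal δ :=
      (monotone_collisionInstant z hk).trans (by rw [hTk]; exact ENNReal.ofReal_le_ofReal hτ.2)
    have h1leR : (collisionInstant G ε z 1).toReal ≤ δ := by
      have := ENNReal.toReal_mono ENNReal.ofReal_ne_top h1le
      rwa [ENNReal.toReal_ofReal hδ.le] at this
    -- contacts at the instants `t_1` and `t_k = τ`
    have hcontact : ∀ {k' : ℕ}, 0 < k' → collisionInstant G ε z k' ≠ ∞ →
        ∃ i j : Fin N, i ≠ j ∧ fwdFlow G ε z (collisionInstant G ε z k').toReal ∈ contactSet G N ε i j := by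
      intro k' hk' hfin'
      obtain ⟨p, hpne, hpc⟩ := hgood.exists_fwdFlow_mem_contactSet hG (toReal_collisionInstant_mem_instantSet hk' hfin')
      exact ⟨p.1, p.2, hpne, hpc⟩
    have ht1τ : (collisionInstant G ε z 1).toReal = τ :=
      huniq _ ⟨hpos1, h1leR⟩ τ hτ (hcontact Nat.one_pos hfin1) ⟨I, J, hIJ, hcτ⟩
    -- the second instant is beyond the window
    have h2 : ENNReal.ofReal δ < collisionInstant G ε z 2 := by
      by_contra hle
      have h2le : collisionInstant G ε z 2 ≤ ENNReal.ofReal δ := not_lt.1 hle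
      have hfin2 : collisionInstant G ε z 2 ≠ ∞ := ne_top_of_le_ne_top ENNReal.ofReal_ne_top h2le
      have hlt := hgood.collisionInstant_lt_succ hG Nat.one_pos hfin1
      have hpos2 : 0 < (collisionInstant G ε z 2).toReal :=
        hpos1.trans ((ENNReal.toReal_lt_toReal hfin1 hfin2).2 hlt)
      have h2leR : (collisionInstant G ε z 2).toReal ≤ δ := by
        have := ENNReal.toReal_mono ENNReal.ofReal_ne_top h2le
        rwa [ENNReal.toReal_ofReal hδ.le] at this
      have heq := huniq _ ⟨hpos1, h1leR⟩ _ ⟨hpos2, h2leR⟩ (hcontact Nat.one_pos hfin1) (hcontact (by norm_num) hfin2)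
      exact (ne_of_lt ((ENNReal.toReal_lt_toReal hfin1 hfin2).2 hlt)) heq
    refine ⟨hzg, ?_, h2, ?_⟩
    · rw [← ENNReal.ofReal_toReal hfin1, ht1τ]; exact ENNReal.ofReal_le_ofReal hτ.2
    · -- the first exit configuration has the positions of the post-collisional configuration at `τ`
      have hexit : freeExitTime G ε (stateAfter G ε z 0) ≠ ∞ := by rwa [stateAfter_zero, ← collisionInstant_one]
      obtain ⟨p, hp, hstate⟩ := hgood.exists_stateAfter_succ hexit
      rw [stateAfter_zero, zero_add, ← collisionInstant_one] at hstate
      have hpost : fwdFlow G ε z (collisionInstant G ε z 1).toReal ∈ contactSet G N ε I J := by rw [ht1τ]; exact hcτ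
      rw [hgood.fwdFlow_collisionInstant hG hfin1 (Or.inl Nat.one_pos), hstate] at hpost
      exact (mem_contactSet_congr_fst fun k => collidePair_apply_fst _ k).1 hpost

end Alexander

end Kinetic

end

end Literature.Analysis.FluidPDE
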